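import Mathlib
import Summits.Parity.GeneralizedHardyLittlewood.Theorems.FordMaynardSieveConst01651SieveConst01651MainCaseH
import Summits.Parity.GeneralizedHardyLittlewood.Theorems.FordMaynardSieveConst01651SieveConst01651RsetSplit

/-!
# Route `FordMaynardSieveConst01651`, target `SieveConst01651` (stmt-Parity-19185), line `sieve_decomposition`:
# helpers towards `stub_typeIIRegion` — the main case `n₁ > 1` RE-INDEXED as a bilinear form in
# (a prime `d` of the smooth part) × (long index `z = (e, m, u')`), `n = d e`, `u = d u'`

Ford–Maynard, arXiv:2407.14368v1, proof of Proposition 7.22 at `P = (1/2, 0, ν)`.  After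
`H(n) = -∑_{m ∣ n₂} ∑_{u ∣ n₁, u ≥ 2, □-free} 𝟙[u m > n^{1/2}] μ(u) g(𝐯(m; n))` (`…MainCaseH.Hwt_eq_neg_sum_main`),
write `u = d u'` with `d = P⁺(u)` (the LARGEST prime of `u`; `d < n^ν ≤ x^ν`, a Type-II variable at `θ = 0`) and
`n = d e`.  The map `(n, m, u) ↦ (d, (e, m, u'))` is a bijection onto the pairs `(d, z)`, `d ∈ (1, x^ν]`,
`z = (e, (m, u'))` with `e ≤ x`, `m ∣ e`, `u' ∣ e`, satisfying: `d` prime, `d < (d e)^ν`, every prime of `m` is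
`≥ (d e)^ν`, every prime of `u'` is `< d`, `u'` squarefree, `x/2 < d e ≤ x`; and `μ(u) = -μ(u')`.  Hence
`∑_{n ∈ ℛ, n₁ > 1} w(n) H(n) = ∑_{d} ∑_{z} 𝟙[conditions] w(d e) 𝟙[d u' m > (d e)^{1/2}] μ(u') g(𝐯(m; d e))`
— a bilinear form whose entangling conditions are all monotone in `d` (`…MainCaseMonotone`).

* `dvd_roughPart_iff`, `dvd_smoothPart_iff` — divisors of `n₂` / `n₁` described by their primes;
* `sup_primeFactors_mem`, `sup_primeFactors_mul`, `lt_sup_of_mem_primeFactors_div` — the largest prime factor;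
* `mainIndex_forward`, `mainIndex_backward` — the two directions of the bijection;
* `sum_main_eq_sum_bilinear` — the re-indexing identity (a sum over the product finset `W₀ ×ˢ Z`).

Def-free. Nothing here proves anything about the Parity summit; helpers for the Type-II region stub of one leaf.
-/

open Finset Literature.NumberTheory.Sieve Literature.NumberTheory.Sieve.FordMaynard

namespace Summit.Parity.GeneralizedHardyLittlewood.FordMaynardSieveConst01651SieveConst01651

/-- **Divisors of the rough part**: for `n ≥ 1`, `m ∣ roughPart y n` iff `m ∣ n` and every prime of `m` is `≥ y`.
[cite: FordMaynard2024PrimeSieves, §7.2 (the factorisation n = n₁ n₂)] -/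
theorem dvd_roughPart_iff {y : ℝ} {n m : ℕ} (hn : n ≠ 0) :
    m ∣ roughPart y n ↔ m ∣ n ∧ ∀ p ∈ m.primeFactors, y ≤ (p : ℝ) := by
  have hr0 := (roughPart_ne_zero_and_dvd y n).1
  have hs0 := smoothPart_ne_zero y hn
  constructor
  · intro h
    refine ⟨h.trans (roughPart_ne_zero_and_dvd y n).2, fun p hp => ?_⟩
    exact le_of_mem_primeFactors_roughPart (Nat.primeFactors_mono h hr0 hp)
  · rintro ⟨hdvd, hprimes⟩
    have hm0 : m ≠ 0 := by rintro rfl; exact hn (zero_dvd_iff.mp hdvd)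
    have hcop : Nat.Coprime m (smoothPart y n) := by
      rw [← Nat.disjoint_primeFactors hm0 hs0]
      exact Finset.disjoint_left.2 fun p hpm hps =>
        (not_le.2 (lt_of_mem_primeFactors_smoothPart hn hps)) (hprimes p hpm)
    have hn' : m ∣ roughPart y n * smoothPart y n := by rwa [roughPart_mul_smoothPart y hn]
    exact hcop.dvd_of_dvd_mul_right hn'

/-- **Divisors of the smooth part**: for `n ≥ 1`, `u ∣ smoothPart y n` iff `u ∣ n` and every prime of `u` is `< y`.
[cite: FordMaynard2024PrimeSieves, §7.2 (the factorisation n = n₁ n₂)] -/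
theorem dvd_smoothPart_iff {y : ℝ} {n u : ℕ} (hn : n ≠ 0) :
    u ∣ smoothPart y n ↔ u ∣ n ∧ ∀ p ∈ u.primeFactors, (p : ℝ) < y := by
  have hr0 := (roughPart_ne_zero_and_dvd y n).1
  have hs0 := smoothPart_ne_zero y hn
  have hsdvd : smoothPart y n ∣ n := Dvd.intro_left _ (roughPart_mul_smoothPart y hn)
  constructor
  · intro h
    refine ⟨h.trans hsdvd, fun p hp => ?_⟩
    exact lt_of_mem_primeFactors_smoothPart hn (Nat.primeFactors_mono h hs0 hp)
  · rintro ⟨hdvd, hprimes⟩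
    have hu0 : u ≠ 0 := by rintro rfl; exact hn (zero_dvd_iff.mp hdvd)
    have hcop : Nat.Coprime u (roughPart y n) := by
      rw [← Nat.disjoint_primeFactors hu0 hr0]
      exact Finset.disjoint_left.2 fun p hpu hpr =>
        (not_le.2 (hprimes p hpu)) (le_of_mem_primeFactors_roughPart hpr)
    have hn' : u ∣ roughPart y n * smoothPart y n := by rwa [roughPart_mul_smoothPart y hn]
    exact hcop.dvd_of_dvd_mul_left hn'

/-- The largest prime factor `P⁺(u) = sup (primeFactors u)` of `u > 1` is a prime factor of `u`. [folklore] -/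
theorem sup_primeFactors_mem {u : ℕ} (hu : 1 < u) : u.primeFactors.sup id ∈ u.primeFactors := by
  obtain ⟨p, hp, h⟩ := Finset.exists_mem_eq_sup _ (Nat.nonempty_primeFactors.2 hu) id
  rw [h]; exact hp

/-- `P⁺(d u') = d` when `d` is prime and every prime of `u' ≥ 1` is `< d`. [folklore] -/
theorem sup_primeFactors_mul {d u' : ℕ} (hd : d.Prime) (hu' : u' ≠ 0)
    (hlt : ∀ p ∈ u'.primeFactors, p < d) : (d * u').primeFactors.sup id = d := by
  rw [Nat.primeFactors_mul hd.ne_zero hu', Finset.sup_union, hd.primeFactors, Finset.sup_singleton, id]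
  refine le_antisymm (sup_le le_rfl (Finset.sup_le fun p hp => (hlt p hp).le)) le_sup_left

/-- For squarefree `u > 1` with largest prime `d = P⁺(u)`: every prime of `u / d` is `< d`. [folklore] -/
theorem lt_sup_of_mem_primeFactors_div {u : ℕ} (hu : 1 < u) (hsq : Squarefree u) {p : ℕ}
    (hp : p ∈ (u / u.primeFactors.sup id).primeFactors) : p < u.primeFactors.sup id := by
  set d := u.primeFactors.sup id with hd
  have hdmem : d ∈ u.primeFactors := sup_primeFactors_mem hu
  have hdprime : d.Prime := Nat.prime_of_mem_primeFactors hdmem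
  have hddvd : d ∣ u := Nat.dvd_of_mem_primeFactors hdmem
  have hu0 : u ≠ 0 := by omega
  have hpu : p ∈ u.primeFactors :=
    Nat.primeFactors_mono (Nat.div_dvd_of_dvd hddvd) hu0 hp
  have hple : p ≤ d := Finset.le_sup (f := id) hpu
  refine lt_of_le_of_ne hple fun hpd => ?_
  -- `p = d` would give `d² ∣ u`
  have hpdvd : p ∣ u / d := Nat.dvd_of_mem_primeFactors hp
  rw [hpd] at hpdvd
  have hsq' : d * d ∣ u := by
    have := Nat.mul_dvd_mul_left d hpdvd
    rwa [Nat.mul_div_cancel' hddvd] at this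
  exact hdprime.one_lt.ne' (Nat.isUnit_iff.mp (hsq d hsq'))

/-- **Forward direction of the re-indexing** `(n, m, u) ↦ (d, (e, m, u'))`, `d = P⁺(u)`, `e = n/d`, `u' = u/d`:
for `n ≥ 2`, `m ∣ n₂`, `u ∣ n₁` with `u ≥ 2` squarefree, the prime `d` divides `u` and `n`, `d < n^ν`,
`m ∣ e`, `u' ∣ e`, every prime of `m` is `≥ n^ν`, every prime of `u'` is `< d`, `u'` is squarefree,
and `μ(u) = -μ(u')`. [cite: FordMaynard2024PrimeSieves, proof of Proposition 7.22 (the Type-II variable)] -/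
theorem mainIndex_forward {ν : ℝ} {n m u : ℕ} (hn : n ≠ 0)
    (hm : m ∣ roughPart ((n : ℝ) ^ ν) n) (hu : u ∣ smoothPart ((n : ℝ) ^ ν) n) (hu2 : 2 ≤ u)
    (husq : Squarefree u) :
    (u.primeFactors.sup id).Prime ∧ u.primeFactors.sup id ∣ u ∧ u.primeFactors.sup id ∣ n ∧
      ((u.primeFactors.sup id : ℕ) : ℝ) < (n : ℝ) ^ ν ∧
      m ∣ n / u.primeFactors.sup id ∧ u / u.primeFactors.sup id ∣ n / u.primeFactors.sup id ∧
      (∀ p ∈ m.primeFactors, (n : ℝ) ^ ν ≤ (p : ℝ)) ∧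
      (∀ p ∈ (u / u.primeFactors.sup id).primeFactors, p < u.primeFactors.sup id) ∧
      Squarefree (u / u.primeFactors.sup id) ∧
      ((ArithmeticFunction.moebius u : ℤ) : ℝ) =
        -((ArithmeticFunction.moebius (u / u.primeFactors.sup id) : ℤ) : ℝ) := by
  set d := u.primeFactors.sup id with hd
  have hdmem : d ∈ u.primeFactors := sup_primeFactors_mem hu2
  have hdprime : d.Prime := Nat.prime_of_mem_primeFactors hdmem
  have hdu : d ∣ u := Nat.dvd_of_mem_primeFactors hdmem
  have hu' := (dvd_smoothPart_iff (y := (n : ℝ) ^ ν) hn).mp hu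
  have hm' := (dvd_roughPart_iff (y := (n : ℝ) ^ ν) hn).mp hm
  have hdn : d ∣ n := hdu.trans hu'.1
  have hu0 : u ≠ 0 := by omega
  have hdlt : (d : ℝ) < (n : ℝ) ^ ν := hu'.2 d hdmem
  have hnde : d * (n / d) = n := Nat.mul_div_cancel' hdn
  have hm0 : m ≠ 0 := by rintro rfl; exact (roughPart_ne_zero_and_dvd _ n).1 (zero_dvd_iff.mp hm)
  have hmcop : Nat.Coprime m d := by
    rw [Nat.coprime_comm, hdprime.coprime_iff_not_dvd]
    intro hdm
    have := hm'.2 d (Nat.mem_primeFactors.mpr ⟨hdprime, hdm, hm0⟩)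
    linarith
  have hme : m ∣ n / d := by
    apply hmcop.dvd_of_dvd_mul_left
    rw [hnde]; exact hm'.1
  have hue : u / d ∣ n / d := by
    have h1 : d * (u / d) ∣ d * (n / d) := by rw [Nat.mul_div_cancel' hdu, hnde]; exact hu'.1
    exact Nat.dvd_of_mul_dvd_mul_left hdprime.pos h1
  have hC3 : ∀ p ∈ (u / d).primeFactors, p < d := fun p hp => lt_sup_of_mem_primeFactors_div hu2 husq hp
  have hq0 : u / d ≠ 0 := (Nat.div_pos (Nat.le_of_dvd (by omega) hdu) hdprime.pos).ne'
  have hμ : ((ArithmeticFunction.moebius u : ℤ) : ℝ) =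
      -((ArithmeticFunction.moebius (u / d) : ℤ) : ℝ) := by
    have hcop : Nat.Coprime d (u / d) := by
      rw [hdprime.coprime_iff_not_dvd]
      intro hdq
      exact lt_irrefl d (hC3 d (Nat.mem_primeFactors.mpr ⟨hdprime, hdq, hq0⟩))
    have h := ArithmeticFunction.isMultiplicative_moebius.map_mul_of_coprime hcop
    rw [Nat.mul_div_cancel' hdu, ArithmeticFunction.moebius_apply_prime hdprime] at h
    rw [h]; push_cast; ring
  exact ⟨hdprime, hdu, hdn, hdlt, hme, hue, hm'.2, hC3, husq.squarefree_of_dvd (Nat.div_dvd_of_dvd hdu), hμ⟩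

/-- **Backward direction of the re-indexing**: for `d` prime, `e ≥ 1`, `m ∣ e`, `u' ∣ e` with `d < (d e)^ν`
(`ν < 1`), every prime of `m` `≥ (d e)^ν`, every prime of `u'` `< d`, `u'` squarefree: `n = d e` is neither prime nor
`n^ν`-rough, its smooth part exceeds `1`, `m ∣ n₂`, `d u' ∣ n₁`, `d u' ≥ 2` is squarefree, and `P⁺(d u') = d`.
[cite: FordMaynard2024PrimeSieves, proof of Proposition 7.22 (the Type-II variable)] -/
theorem mainIndex_backward {ν : ℝ} (hν1 : ν < 1) {d e m u' : ℕ} (hd : d.Prime) (he : e ≠ 0)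
    (hm : m ∣ e) (hu' : u' ∣ e) (hC1 : (d : ℝ) < ((d * e : ℕ) : ℝ) ^ ν)
    (hC2 : ∀ p ∈ m.primeFactors, ((d * e : ℕ) : ℝ) ^ ν ≤ (p : ℝ))
    (hC3 : ∀ p ∈ u'.primeFactors, p < d) (husq : Squarefree u') :
    d * e ≠ 0 ∧ ¬ (d * e).Prime ∧ ¬ IsRough ν (d * e) ∧
      1 < smoothPart (((d * e : ℕ) : ℝ) ^ ν) (d * e) ∧
      m ∣ roughPart (((d * e : ℕ) : ℝ) ^ ν) (d * e) ∧ d * u' ∣ smoothPart (((d * e : ℕ) : ℝ) ^ ν) (d * e) ∧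
      2 ≤ d * u' ∧ Squarefree (d * u') ∧ (d * u').primeFactors.sup id = d := by
  have hu0 : u' ≠ 0 := by rintro rfl; exact he (zero_dvd_iff.mp hu')
  have hn0 : d * e ≠ 0 := Nat.mul_ne_zero hd.ne_zero he
  have hdmem : d ∈ (d * e).primeFactors := Nat.mem_primeFactors.mpr ⟨hd, dvd_mul_right d e, hn0⟩
  have h1n : 1 < d * e := lt_of_lt_of_le hd.one_lt (Nat.le_mul_of_pos_right d (Nat.pos_of_ne_zero he))
  have hdltn : d < d * e := by
    have h1 : ((d * e : ℕ) : ℝ) ^ ν < ((d * e : ℕ) : ℝ) ^ (1 : ℝ) :=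
      Real.rpow_lt_rpow_of_exponent_lt (by exact_mod_cast h1n) hν1
    rw [Real.rpow_one] at h1
    exact_mod_cast hC1.trans h1
  refine ⟨hn0, fun hpr => ?_, fun hr => absurd (hr d hdmem) (not_lt.mpr hC1.le),
    one_lt_smoothPart_of_lt hn0 hdmem hC1, ?_, ?_, ?_, ?_, sup_primeFactors_mul hd hu0 hC3⟩
  · rcases hpr.eq_one_or_self_of_dvd d (dvd_mul_right d e) with h | h
    · exact hd.one_lt.ne' h
    · exact hdltn.ne h
  · exact (dvd_roughPart_iff hn0).mpr ⟨hm.trans (dvd_mul_left e d), hC2⟩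
  · refine (dvd_smoothPart_iff hn0).mpr ⟨Nat.mul_dvd_mul_left d hu', fun p hp => ?_⟩
    rw [Nat.primeFactors_mul hd.ne_zero hu0, Finset.mem_union, hd.primeFactors, Finset.mem_singleton] at hp
    rcases hp with rfl | hp
    · exact hC1
    · have : (p : ℝ) < d := by exact_mod_cast hC3 p hp
      exact this.trans hC1
  · exact le_trans hd.two_le (Nat.le_mul_of_pos_right d (Nat.pos_of_ne_zero hu0))
  · rw [Nat.squarefree_mul_iff]
    refine ⟨hd.coprime_iff_not_dvd.mpr fun hdu => ?_, hd.prime.squarefree, husq⟩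
    exact lt_irrefl d (hC3 d (Nat.mem_primeFactors.mpr ⟨hd, hdu, hu0⟩))

/-- **The main case as a bilinear form in `(d, z)`** (`d = P⁺(u)` the largest prime of `u = d u'`, `n = d e`,
`z = (e, (m, u'))`).  For `g` with the support clause of `Admissible ν g`, `0 < ν < 1`, `x ≥ 2` and any `w`:
`∑_{n ∈ ℛ, n₁ > 1} w(n) H(n) = ∑_{(d, z)} 𝟙[d prime, d < (de)^ν, primes(m) ≥ (de)^ν, primes(u') < d,
u' □-free, x/2 < de ≤ x] · w(de) · 𝟙[d u' m > (de)^{1/2}] μ(u') g(𝐯(m; de))`, over the product of the Type-II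
range `(Icc 1 ⌊x^{0+ν}⌋).filter ((x/2)^0 < d)` of (II) at `θ = 0` with the long index set
`{(e, (m, u')) : e ≤ x, m ∣ e, u' ∣ e}`. [cite: FordMaynard2024PrimeSieves, proof of Proposition 7.22 (re-indexing by the Type-II variable)] -/
theorem sum_main_eq_sum_bilinear {ν : ℝ} (hν0 : 0 < ν) (hν1 : ν < 1) {g : VecFn}
    (hsupp : ∀ (k : ℕ) (x : Fin k → ℝ), g k x ≠ 0 → k = 0 ∨ ((∀ i, ν < x i) ∧ ∑ i, x i ≤ 1 / 2))
    {x : ℝ} (hx : 2 ≤ x) (w : ℕ → ℝ) :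
    ∑ n ∈ (Rset ν x).filter (fun n : ℕ => 1 < smoothPart ((n : ℝ) ^ ν) n), w n * Hwt g ν n =
      ∑ b ∈ ((Icc 1 ⌊x ^ ((0 : ℝ) + ν)⌋₊).filter (fun m : ℕ => (x / 2) ^ (0 : ℝ) < (m : ℝ))) ×ˢ
          ((Icc 1 ⌊x⌋₊).biUnion
            (fun e : ℕ => (e.divisors ×ˢ e.divisors).image (fun s : ℕ × ℕ => (e, s)))),
        if (b.1.Prime ∧ (b.1 : ℝ) < ((b.1 * b.2.1 : ℕ) : ℝ) ^ ν ∧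
              (∀ p ∈ b.2.2.1.primeFactors, ((b.1 * b.2.1 : ℕ) : ℝ) ^ ν ≤ (p : ℝ)) ∧
              (∀ p ∈ b.2.2.2.primeFactors, p < b.1) ∧ Squarefree b.2.2.2 ∧
              (x / 2 < (b.1 * b.2.1 : ℝ) ∧ (b.1 * b.2.1 : ℝ) ≤ x)) then
            w (b.1 * b.2.1) *
              (if ((b.1 * b.2.2.2 * b.2.2.1 : ℕ) : ℝ) ≤ ((b.1 * b.2.1 : ℕ) : ℝ) ^ (1 / 2 : ℝ) then 0
                else ((ArithmeticFunction.moebius b.2.2.2 : ℤ) : ℝ) *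
                  g _ (pvec (b.1 * b.2.1) b.2.2.1))
          else 0 := by
  classical
  set Main := (Rset ν x).filter (fun n : ℕ => 1 < smoothPart ((n : ℝ) ^ ν) n) with hMainDef
  set W₀ := (Icc 1 ⌊x ^ ((0 : ℝ) + ν)⌋₊).filter (fun m : ℕ => (x / 2) ^ (0 : ℝ) < (m : ℝ)) with hW₀
  set Z := (Icc 1 ⌊x⌋₊).biUnion
      (fun e : ℕ => (e.divisors ×ˢ e.divisors).image (fun s : ℕ × ℕ => (e, s))) with hZ
  clear_value Main W₀ Z
  -- membership facts
  have hMain : ∀ n ∈ Main, n ∈ window x ∧ 2 ≤ n ∧ 1 < smoothPart ((n : ℝ) ^ ν) n := by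
    intro n hn
    rw [hMainDef, Finset.mem_filter] at hn
    have hw := (mem_Rset.mp hn.1).1
    exact ⟨hw, two_le_of_mem_window hx hw, hn.2⟩
  have hZmem : ∀ z : ℕ × (ℕ × ℕ), z ∈ Z ↔
      z.1 ∈ Icc 1 ⌊x⌋₊ ∧ z.2.1 ∈ z.1.divisors ∧ z.2.2 ∈ z.1.divisors := by
    intro z
    rw [hZ, Finset.mem_biUnion]
    constructor
    · rintro ⟨e, he, hz⟩
      rw [Finset.mem_image] at hz
      obtain ⟨s, hs, rfl⟩ := hz
      rw [Finset.mem_product] at hs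
      exact ⟨he, hs.1, hs.2⟩
    · rintro ⟨he, hm, hu⟩
      refine ⟨z.1, he, ?_⟩
      rw [Finset.mem_image]
      exact ⟨z.2, Finset.mem_product.mpr ⟨hm, hu⟩, rfl⟩
  have hW₀mem : ∀ d : ℕ, d ∈ W₀ ↔ (1 ≤ d ∧ d ≤ ⌊x ^ ν⌋₊) ∧ 1 < d := by
    intro d
    rw [hW₀, Finset.mem_filter, Finset.mem_Icc, zero_add, Real.rpow_zero]
    exact ⟨fun h => ⟨h.1, by exact_mod_cast h.2⟩, fun h => ⟨h.1, by exact_mod_cast h.2⟩⟩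
  -- LHS as a sum over the sigma-finset of triples `(n, (m, u))`
  have hL : ∑ n ∈ Main, w n * Hwt g ν n =
      ∑ a ∈ Main.sigma (fun n : ℕ => (roughPart ((n : ℝ) ^ ν) n).divisors ×ˢ
          ((smoothPart ((n : ℝ) ^ ν) n).divisors.filter (fun u : ℕ => 2 ≤ u ∧ Squarefree u))),
        -(w a.1 * (if ((a.2.2 * a.2.1 : ℕ) : ℝ) ≤ ((a.1 : ℕ) : ℝ) ^ (1 / 2 : ℝ) then 0
          else ((ArithmeticFunction.moebius a.2.2 : ℤ) : ℝ) * g _ (pvec a.1 a.2.1))) := by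
    rw [Finset.sum_sigma]
    refine Finset.sum_congr rfl fun n hn => ?_
    obtain ⟨_, hn2, hn1⟩ := hMain n hn
    rw [Hwt_eq_neg_sum_main hsupp hn2 hn1, mul_neg, Finset.mul_sum, Finset.sum_product,
      ← Finset.sum_neg_distrib]
    refine Finset.sum_congr rfl fun m _ => ?_
    rw [Finset.mul_sum, ← Finset.sum_neg_distrib]
  rw [hL]
  -- the bijection onto the support of the right-hand side
  refine Finset.sum_bij_ne_zero
    (fun a _ _ => (a.2.2.primeFactors.sup id,
      (a.1 / a.2.2.primeFactors.sup id, (a.2.1, a.2.2 / a.2.2.primeFactors.sup id)))) ?_ ?_ ?_ ?_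
  · -- maps into `W₀ ×ˢ Z`
    rintro ⟨n, m, u⟩ ha _
    rw [Finset.mem_sigma, Finset.mem_product, Finset.mem_filter] at ha
    obtain ⟨hnM, hm, hu, hu2, husq⟩ := ha
    have hnM' : n ∈ Main := hnM
    obtain ⟨hnw, hn2, _⟩ := hMain n hnM'
    have hn0 : n ≠ 0 := by omega
    obtain ⟨hdprime, hdu, hdn, hdlt, hme, hue, hC2, hC3, husq', hμ⟩ :=
      mainIndex_forward (ν := ν) hn0 (Nat.dvd_of_mem_divisors hm) (Nat.dvd_of_mem_divisors hu) hu2 husq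
    have hnx' : n ≤ ⌊x⌋₊ := (mem_window.mp hnw).1.2
    have hnx : (n : ℝ) ≤ x := (Nat.cast_le.mpr hnx').trans (Nat.floor_le (by linarith))
    have he1 : 1 ≤ n / u.primeFactors.sup id := Nat.div_pos (Nat.le_of_dvd (by omega) hdn) hdprime.pos
    rw [Finset.mem_product, hW₀mem, hZmem]
    simp only
    refine ⟨⟨⟨hdprime.pos, Nat.le_floor ?_⟩, hdprime.one_lt⟩, Finset.mem_Icc.mpr ⟨he1, ?_⟩,
      Nat.mem_divisors.mpr ⟨hme, by omega⟩, Nat.mem_divisors.mpr ⟨hue, by omega⟩⟩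
    · exact (hdlt.trans_le (Real.rpow_le_rpow (Nat.cast_nonneg _) hnx hν0.le)).le
    · exact (Nat.div_le_self n _).trans hnx'
  · -- injective (left inverse)
    rintro ⟨n₁, m₁, u₁⟩ ha₁ _ ⟨n₂, m₂, u₂⟩ ha₂ _ heq
    rw [Finset.mem_sigma, Finset.mem_product, Finset.mem_filter] at ha₁ ha₂
    obtain ⟨hnM₁, hm₁, hu₁, hu2₁, husq₁⟩ := ha₁
    obtain ⟨hnM₂, hm₂, hu₂, hu2₂, husq₂⟩ := ha₂
    have hn0₁ : n₁ ≠ 0 := by have := (hMain n₁ hnM₁).2.1; omega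
    have hn0₂ : n₂ ≠ 0 := by have := (hMain n₂ hnM₂).2.1; omega
    obtain ⟨_, hdu₁, hdn₁, -⟩ :=
      mainIndex_forward (ν := ν) hn0₁ (Nat.dvd_of_mem_divisors hm₁) (Nat.dvd_of_mem_divisors hu₁) hu2₁ husq₁
    obtain ⟨_, hdu₂, hdn₂, -⟩ :=
      mainIndex_forward (ν := ν) hn0₂ (Nat.dvd_of_mem_divisors hm₂) (Nat.dvd_of_mem_divisors hu₂) hu2₂ husq₂
    have hdu₁' : u₁.primeFactors.sup id ∣ u₁ := hdu₁
    have hdn₁' : u₁.primeFactors.sup id ∣ n₁ := hdn₁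
    have hdu₂' : u₂.primeFactors.sup id ∣ u₂ := hdu₂
    have hdn₂' : u₂.primeFactors.sup id ∣ n₂ := hdn₂
    simp only [Prod.mk.injEq] at heq
    obtain ⟨hd, he, hm, hu⟩ := heq
    have hn : n₁ = n₂ := by
      calc n₁ = u₁.primeFactors.sup id * (n₁ / u₁.primeFactors.sup id) := (Nat.mul_div_cancel' hdn₁').symm
        _ = u₂.primeFactors.sup id * (n₂ / u₂.primeFactors.sup id) := by rw [he, hd]
        _ = n₂ := Nat.mul_div_cancel' hdn₂'
    have huu : u₁ = u₂ := by
      calc u₁ = u₁.primeFactors.sup id * (u₁ / u₁.primeFactors.sup id) := (Nat.mul_div_cancel' hdu₁').symm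
        _ = u₂.primeFactors.sup id * (u₂ / u₂.primeFactors.sup id) := by rw [hu, hd]
        _ = u₂ := Nat.mul_div_cancel' hdu₂'
    subst hn; subst huu; subst hm
    rfl
  · -- surjective onto the support
    rintro ⟨d, e, m, u'⟩ hb hne
    rw [Finset.mem_product, hW₀mem, hZmem] at hb
    obtain ⟨⟨⟨hd1, hdx⟩, hd2⟩, he, hm, hu'⟩ := hb
    simp only at he hm hu' hne
    -- the conditions hold, since the summand is non-zero
    have hcond : d.Prime ∧ (d : ℝ) < ((d * e : ℕ) : ℝ) ^ ν ∧
        (∀ p ∈ m.primeFactors, ((d * e : ℕ) : ℝ) ^ ν ≤ (p : ℝ)) ∧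
        (∀ p ∈ u'.primeFactors, p < d) ∧ Squarefree u' ∧
        (x / 2 < (d * e : ℝ) ∧ (d * e : ℝ) ≤ x) := by
      by_contra h
      exact hne (by rw [if_neg h])
    obtain ⟨hdprime, hC1, hC2, hC3, husq, hwin⟩ := hcond
    have he0 : e ≠ 0 := by have := (Finset.mem_Icc.mp he).1; omega
    obtain ⟨hn0, hnp, hnr, hn1, hm2, hu1, h2u, husq2, hsup⟩ :=
      mainIndex_backward hν1 hdprime he0 (Nat.dvd_of_mem_divisors hm) (Nat.dvd_of_mem_divisors hu')
        hC1 hC2 hC3 husq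
    have hnle : d * e ≤ ⌊x⌋₊ := Nat.le_floor (by push_cast; exact hwin.2)
    have hnw : d * e ∈ window x := by
      rw [mem_window]
      exact ⟨⟨Nat.pos_of_ne_zero hn0, hnle⟩, by push_cast; exact hwin.1⟩
    have hnM : d * e ∈ Main := by
      rw [hMainDef, Finset.mem_filter, mem_Rset]
      exact ⟨⟨hnw, hnp, fun h => hnr h.2⟩, hn1⟩
    have hmemS : (⟨d * e, (m, d * u')⟩ : Σ _ : ℕ, ℕ × ℕ) ∈ Main.sigma (fun n : ℕ =>
        (roughPart ((n : ℝ) ^ ν) n).divisors ×ˢ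
          ((smoothPart ((n : ℝ) ^ ν) n).divisors.filter (fun u : ℕ => 2 ≤ u ∧ Squarefree u))) := by
      rw [Finset.mem_sigma, Finset.mem_product, Finset.mem_filter]
      exact ⟨hnM, Nat.mem_divisors.mpr ⟨hm2, (roughPart_ne_zero_and_dvd _ _).1⟩,
        Nat.mem_divisors.mpr ⟨hu1, smoothPart_ne_zero _ hn0⟩, h2u, husq2⟩
    have himage : (( (d * u').primeFactors.sup id,
        (d * e / (d * u').primeFactors.sup id, (m, d * u' / (d * u').primeFactors.sup id))) :
          ℕ × (ℕ × (ℕ × ℕ))) = (d, (e, (m, u'))) := by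
      simp only [hsup, Nat.mul_div_cancel_left _ hdprime.pos]
    refine ⟨⟨d * e, (m, d * u')⟩, hmemS, ?_, himage⟩
    -- the summand at the preimage is non-zero: it equals the (non-zero) target summand
    intro hzero
    apply hne
    obtain ⟨_, _, _, _, _, _, _, _, _, hμ⟩ :=
      mainIndex_forward (ν := ν) hn0 hm2 hu1 h2u husq2
    rw [hsup, Nat.mul_div_cancel_left _ hdprime.pos] at hμ
    rw [if_pos (show _ ∧ _ ∧ _ ∧ _ ∧ _ ∧ _ from ⟨hdprime, hC1, hC2, hC3, husq, hwin⟩)]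
    simp only [hμ] at hzero
    have : w (d * e) * (if ((d * u' * m : ℕ) : ℝ) ≤ ((d * e : ℕ) : ℝ) ^ (1 / 2 : ℝ) then 0
        else ((ArithmeticFunction.moebius u' : ℤ) : ℝ) * g _ (pvec (d * e) m)) =
        -(w (d * e) * (if ((d * u' * m : ℕ) : ℝ) ≤ ((d * e : ℕ) : ℝ) ^ (1 / 2 : ℝ) then 0
          else -((ArithmeticFunction.moebius u' : ℤ) : ℝ) * g _ (pvec (d * e) m))) := by
      split_ifs <;> ring
    rw [this, hzero]
  · -- the summands agree
    rintro ⟨n, m, u⟩ ha _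
    rw [Finset.mem_sigma, Finset.mem_product, Finset.mem_filter] at ha
    obtain ⟨hnM, hm, hu, hu2, husq⟩ := ha
    have hnM' : n ∈ Main := hnM
    obtain ⟨hnw, hn2, _⟩ := hMain n hnM'
    have hn0 : n ≠ 0 := by omega
    obtain ⟨hdprime, hdu, hdn, hdlt, hme, hue, hC2, hC3, husq', hμ⟩ :=
      mainIndex_forward (ν := ν) hn0 (Nat.dvd_of_mem_divisors hm) (Nat.dvd_of_mem_divisors hu) hu2 husq
    have hnx' : n ≤ ⌊x⌋₊ := (mem_window.mp hnw).1.2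
    have hnx : (n : ℝ) ≤ x := (Nat.cast_le.mpr hnx').trans (Nat.floor_le (by linarith))
    simp only [Nat.mul_div_cancel' hdn, Nat.mul_div_cancel' hdu]
    have hwin : x / 2 < ((u.primeFactors.sup id : ℕ) : ℝ) * ((n / u.primeFactors.sup id : ℕ) : ℝ) ∧
        ((u.primeFactors.sup id : ℕ) : ℝ) * ((n / u.primeFactors.sup id : ℕ) : ℝ) ≤ x := by
      have : ((u.primeFactors.sup id : ℕ) : ℝ) * ((n / u.primeFactors.sup id : ℕ) : ℝ) = n := by
        exact_mod_cast Nat.mul_div_cancel' hdn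
      rw [this]; exact ⟨(mem_window.mp hnw).2, hnx⟩
    have hdlt' : ((u.primeFactors.sup id : ℕ) : ℝ) < ((n : ℕ) : ℝ) ^ ν := hdlt
    rw [if_pos (show _ ∧ _ ∧ _ ∧ _ ∧ _ ∧ _ from ⟨hdprime, hdlt', hC2, hC3, husq', hwin⟩), hμ]
    split_ifs <;> ring

end Summit.Parity.GeneralizedHardyLittlewood.FordMaynardSieveConst01651SieveConst01651
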